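import Summits.KontsevichZagierPeriods.Zeta5Search.Barrier.ConeGammaLogCuspGamma

/-!
# ζ(5) search — BARRIER: the CUSP SLOPE `cuspSlope a T δ` as a named object, and the log-cusp theorems in its terms

HONEST FRAMING (cell `pub-zeta5`): systematic search; no irrationality claim unless kernel-certified. MODEL objects
under Brown–Zudilin's (28)+(30) accounting ([BZ22] = arXiv:2210.03391); nothing here is a statement about `ζ(5)`,
about the cone's supremum (C2 = `BarrierC2` OPEN) or about the sign or size of the slope at any direction; the
lemma S-E stays CONJECTURED; records in print UNMOVED. Prover P2 g19 (lead/lit g34 ruling, INBOX l.8943: «the ONE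
`def cuspSlope` … state in its docstring that it equals the Lemma-B slope / the germ sum and is scale-independent,
with the lemma that proves it»).

* **`cuspSlope a T δ`** — the one-sided slope of the translate integral `P = translateIntegral a T` at `0` in the
  direction `δ`: `(P(ρ₀δ) − P(0))/ρ₀` at the admissible scale `ρ₀` of `exists_admissible_scale` (value `0` off the
  domain «all 28 forms of `a` positive and `T > 0`», where it is not used). P2 g11's `Σ_b K_b(δ)`; the lane's
  `λ₀·S(t₀; v(δ))` at `T = λ₀`.
* `cuspSlope_spec` — **scale independence** (Lemma B, `translateIntegral_sub_eq_mul_slope`): `P(ρδ) − P(0) =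
  ρ·cuspSlope a T δ` for EVERY admissible `ρ` (`ρK < 1`, `ρK < d`, `2ρW ≤` every breakpoint gap);
* `cuspSlope_eq_sum_germs` — **the germ sum** (`translateIntegral_shift_eq_sum_germs`): at every admissible `ρ`,
  `cuspSlope a T δ = Σ_{m<M} (germR a δ ρ b_m + germL a δ ρ b_{m+1})`;
* `phi30_logCusp_cuspSlope`, `phi30_logCusp_openBox_cuspSlope`, `gamma_logCusp_of_lipschitz_cuspSlope` — the
  theorems of `ConeGammaLogCusp` / `ConeGammaLogCuspGamma` with the existential slope `σ` NAMED:
  `|Φ(s(a)+εδ) − Φ(s(a)) − (cuspSlope a T δ / T)·ε·log(1/ε)| ≤ C·ε` (`0 < ε ≤ ε₁`), etc.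
-/

noncomputable section

open Set MeasureTheory
open scoped Topology

namespace Summit.KontsevichZagierPeriods.Zeta5Search.Barrier.ConeGamma

open scoped Classical in
/-- **The cusp slope of `Φ` at the direction `a` (period `T`) in the displacement direction `δ`**: the one-sided
derivative at `0` of the translate integral `ρ ↦ P(ρδ) = translateIntegral a T (ρ•δ)`, realised as the difference
quotient `(P(ρ₀δ) − P(0))/ρ₀` at the admissible scale `ρ₀` of `exists_admissible_scale`. By Lemma B it EQUALS the
difference quotient at EVERY admissible scale (`cuspSlope_spec`) and the finite GERM SUM
`Σ_m (germR ρ b_m + germL ρ b_{m+1})` (`cuspSlope_eq_sum_germs`) — P2 g11's `Σ_b K_b(δ)`, the lane's `λ₀·S(t₀; v(δ))`.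
Off the domain (some form of `a` non-positive, or `T ≤ 0`) the value is `0` and carries no meaning. The coefficient
of `ε·log(1/ε)` in `Φ(s(a)+εδ) − Φ(s(a))` is `cuspSlope a T δ / T` (`phi30_logCusp_cuspSlope`). No sign or value of
it at any direction is asserted anywhere in the tree. -/
def cuspSlope (a : Dir) (T : ℝ) (δ : Fin 8 → ℝ) : ℝ :=
  if h : (∀ k, 0 < h28 a k) ∧ 0 < T then
    (translateIntegral a T ((Classical.choose (exists_admissible_scale h.1 h.2 δ)) • δ) -
        translateIntegral a T 0) / Classical.choose (exists_admissible_scale h.1 h.2 δ)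
  else 0

/-- **Scale independence (Lemma B).** For every admissible scale `ρ`: `P(ρδ) − P(0) = ρ · cuspSlope a T δ`. -/
theorem cuspSlope_spec {a : Dir} (hpos : ∀ k, 0 < h28 a k) {T : ℝ} (hT : 0 < T)
    (hper : ∀ k : Fin 28, ∃ z : ℤ, T * h28 a k = z) (δ : Fin 8 → ℝ) {ρ : ℝ} (hρ : 0 < ρ)
    (h1 : ρ * clusterBound a δ < 1) (h2 : ρ * clusterBound a δ < wallDist a T)
    (hgap : ∀ m, m + 1 < (bkpts a T).card → 2 * ρ * clusterWidth a δ ≤ bkpt a T (m + 1) - bkpt a T m) :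
    translateIntegral a T (ρ • δ) - translateIntegral a T 0 = ρ * cuspSlope a T δ := by
  unfold cuspSlope
  rw [dif_pos ⟨hpos, hT⟩]
  obtain ⟨hρ₀, h1₀, h2₀, hgap₀⟩ := Classical.choose_spec (exists_admissible_scale hpos hT δ)
  exact translateIntegral_sub_eq_mul_slope hpos hT hper δ hρ₀ h1₀ h2₀ hgap₀ hρ h1 h2 hgap

/-- **The germ sum.** At every admissible scale `ρ`, `cuspSlope a T δ = Σ_{m<M} (germR ρ b_m + germL ρ b_{m+1})`. -/
theorem cuspSlope_eq_sum_germs {a : Dir} (hpos : ∀ k, 0 < h28 a k) {T : ℝ} (hT : 0 < T)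
    (hper : ∀ k : Fin 28, ∃ z : ℤ, T * h28 a k = z) (δ : Fin 8 → ℝ) {ρ : ℝ} (hρ : 0 < ρ)
    (h1 : ρ * clusterBound a δ < 1) (h2 : ρ * clusterBound a δ < wallDist a T)
    (hgap : ∀ m, m + 1 < (bkpts a T).card → 2 * ρ * clusterWidth a δ ≤ bkpt a T (m + 1) - bkpt a T m) :
    cuspSlope a T δ = ∑ m ∈ Finset.range ((bkpts a T).card - 1),
      (germR a δ ρ (bkpt a T m) + germL a δ ρ (bkpt a T (m + 1))) := by
  have hB := cuspSlope_spec hpos hT hper δ hρ h1 h2 hgap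
  have hG := translateIntegral_shift_eq_sum_germs hpos hT hper δ hρ h1 hgap
  rw [hB] at hG
  exact mul_left_cancel₀ hρ.ne' hG

/-- The existential slope of `phi30_logCusp` IS `cuspSlope`: any `σ` with the Lemma-B characterisation equals it. -/
theorem eq_cuspSlope_of_spec {a : Dir} (hpos : ∀ k, 0 < h28 a k) {T : ℝ} (hT : 0 < T)
    (hper : ∀ k : Fin 28, ∃ z : ℤ, T * h28 a k = z) (δ : Fin 8 → ℝ) {σ : ℝ}
    (hσ : ∀ ρ, 0 < ρ → ρ * clusterBound a δ < 1 → ρ * clusterBound a δ < wallDist a T →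
      (∀ m, m + 1 < (bkpts a T).card → 2 * ρ * clusterWidth a δ ≤ bkpt a T (m + 1) - bkpt a T m) →
      translateIntegral a T (ρ • δ) - translateIntegral a T 0 = ρ * σ) : σ = cuspSlope a T δ := by
  obtain ⟨ρ, hρ, h1, h2, hgap⟩ := exists_admissible_scale hpos hT δ
  have e1 := hσ ρ hρ h1 h2 hgap
  have e2 := cuspSlope_spec hpos hT hper δ hρ h1 h2 hgap
  rw [e1] at e2
  exact mul_left_cancel₀ hρ.ne' e2

/-- **The log-cusp expansion with the named slope** (closed box, all forms positive):
`|Φ(s(a)+εδ) − Φ(s(a)) − (cuspSlope a T δ / T)·ε·log(1/ε)| ≤ C·ε` for `0 < ε ≤ ε₁` (perturbed direction in the box). -/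
theorem phi30_logCusp_cuspSlope {a : Dir} (ha : BZBox a) (hpos : ∀ k, 0 < h28 a k) {T : ℝ} (hT : 0 < T)
    (hper : ∀ k : Fin 28, ∃ z : ℤ, T * h28 a k = z) (δ : Fin 8 → ℝ) :
    ∃ C ε₁ : ℝ, 0 < ε₁ ∧ ∀ ε, 0 < ε → ε ≤ ε₁ → BZBox (aOfS (sParam a + ε • δ)) →
      |phi30 (aOfS (sParam a + ε • δ)) - phi30 a - cuspSlope a T δ / T * ε * Real.log (1 / ε)| ≤ C * ε := by
  obtain ⟨σ, C, ε₁, hε₁, hσ, hexp⟩ := phi30_logCusp ha hpos hT hper δ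
  rw [eq_cuspSlope_of_spec hpos hT hper δ hσ] at hexp
  exact ⟨C, ε₁, hε₁, hexp⟩

/-- **The log-cusp expansion with the named slope, open box** (no side condition on the perturbed direction). -/
theorem phi30_logCusp_openBox_cuspSlope {a : Dir}
    (hopen : ∀ j : Fin 7, 0 < sParam a j.succ ∧ sParam a j.succ < sParam a 0)
    {T : ℝ} (hT : 0 < T) (hper : ∀ k : Fin 28, ∃ z : ℤ, T * h28 a k = z) (δ : Fin 8 → ℝ) :
    ∃ C ε₁ : ℝ, 0 < ε₁ ∧ ∀ ε, 0 < ε → ε ≤ ε₁ →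
      |phi30 (aOfS (sParam a + ε • δ)) - phi30 a - cuspSlope a T δ / T * ε * Real.log (1 / ε)| ≤ C * ε := by
  obtain ⟨σ, C, ε₁, hε₁, hσ, hexp⟩ := phi30_logCusp_openBox hopen hT hper δ
  rw [eq_cuspSlope_of_spec (h28_pos_of_openBox hopen) hT hper δ hσ] at hexp
  exact ⟨C, ε₁, hε₁, hexp⟩

/-- **Cor. 1 with the named slope**: `cuspSlope > 0 ⇒` the difference quotient `→ +∞`, `< 0 ⇒ → −∞`. -/
theorem phi30_diffQuot_tendsto_cuspSlope {a : Dir}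
    (hopen : ∀ j : Fin 7, 0 < sParam a j.succ ∧ sParam a j.succ < sParam a 0)
    {T : ℝ} (hT : 0 < T) (hper : ∀ k : Fin 28, ∃ z : ℤ, T * h28 a k = z) (δ : Fin 8 → ℝ) :
    (0 < cuspSlope a T δ → Filter.Tendsto (fun ε => (phi30 (aOfS (sParam a + ε • δ)) - phi30 a) / ε)
        (𝓝[>] 0) Filter.atTop) ∧
      (cuspSlope a T δ < 0 → Filter.Tendsto (fun ε => (phi30 (aOfS (sParam a + ε • δ)) - phi30 a) / ε)
        (𝓝[>] 0) Filter.atBot) := by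
  obtain ⟨σ, hσ, hup, hdown⟩ := phi30_diffQuot_tendsto_of_slope hopen hT hper δ
  rw [eq_cuspSlope_of_spec (h28_pos_of_openBox hopen) hT hper δ hσ] at hup hdown
  exact ⟨hup, hdown⟩

/-- **Cor. 2 with the named slope** (conditional on local Lipschitz `C₀`, `C₁` along the ray): `γ` inherits the
log-cusp with coefficient `((C₁−C₀)/Q²)·(cuspSlope a T δ / T)`. -/
theorem gamma_logCusp_of_lipschitz_cuspSlope {a : Dir}
    (hopen : ∀ j : Fin 7, 0 < sParam a j.succ ∧ sParam a j.succ < sParam a 0)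
    {T : ℝ} (hT : 0 < T) (hper : ∀ k : Fin 28, ∃ z : ℤ, T * h28 a k = z) (δ : Fin 8 → ℝ)
    (hQ : 0 < C1 a + delta28 a - phi30 a) {L ε₃ : ℝ} (hL : 0 ≤ L) (hε₃ : 0 < ε₃)
    (hC1 : ∀ ε, 0 < ε → ε ≤ ε₃ → |C1 (aOfS (sParam a + ε • δ)) - C1 a| ≤ L * ε)
    (hC0 : ∀ ε, 0 < ε → ε ≤ ε₃ → |C0 (aOfS (sParam a + ε • δ)) - C0 a| ≤ L * ε) :
    ∃ C' ε₄ : ℝ, 0 < ε₄ ∧ ∀ ε, 0 < ε → ε ≤ ε₄ →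
      |gamma (aOfS (sParam a + ε • δ)) - gamma a
        - (C1 a - C0 a) / (C1 a + delta28 a - phi30 a) ^ 2 * (cuspSlope a T δ / T) * ε * Real.log (1 / ε)|
          ≤ C' * ε := by
  obtain ⟨σ, C', ε₄, hε₄, hσ, hexp⟩ := gamma_logCusp_of_lipschitz hopen hT hper δ hQ hL hε₃ hC1 hC0
  rw [eq_cuspSlope_of_spec (h28_pos_of_openBox hopen) hT hper δ hσ] at hexp
  exact ⟨C', ε₄, hε₄, hexp⟩

end Summit.KontsevichZagierPeriods.Zeta5Search.Barrier.ConeGamma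

end
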